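import Mathlib
import HarnessLib
import Summits.HubbardSuperconductivity.HubbardSuperconductivity.Theorems.KLProgrammePerturbedFermiCurveCausticCount
import Summits.HubbardSuperconductivity.HubbardSuperconductivity.Theorems.KLProgrammeKLRegimeTwoPointLimitShellAngularCaustic

/-!
# Route `KLProgramme` — ENGINE child (stmt-HubbardSuperconductivity-20437 `KLRegimeEngineV17F2`): the SQUARE-ROOT LAW of the two-shell bound on the frame's
# Fermi curve — the angular sublevel measure in the CAUSTIC regime (step (T2)-caustic assembled; design note HOME/hubbard-kl-k3c2-p2/TWO-SHELL-FRAME-PORT.md §6–§8)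

Cell `gate-hubbard-kl`, seat hubbard-kl-k3c2-p2 g15.  Frame twin of p1b's `klsh_volume_sublevel_le_caustic` (`…ShellAngularCausticMain`): for a transfer `v` NOT
`R₀`-close to `2πℤ²` (possibly ON the caustic `2F + 2πℤ²`), the sublevel set `T = {θ ∈ [θ₀, θ₀ + 2π] : |E(p(θ) − v) − ν| ≤ δ}` of the frame curve
`p = perturbedFermiRadius δ_K ν·dir` satisfies
  `|T| ≤ 3(2π/ℓ + 97)·(δ/λ) + 48·6√(δ/c)`        (**`volume_sublevel_le_caustic_of_geomConstants`**):
GOOD points (slope `≥ 2λ` on the `δ/2λ`-ball inside `T`) are within `δ/2λ` of a zero (`klsg_exists_zero_near`) and the zeros of three periods number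
`≤ 3(2π/ℓ + 97)` (`zeros_card_le_awayFromCooper_frame`); BAD points are within `δ/2λ` of a near-tangent point, which is odd-aligned
(`nearTangent_near_caustic_momentum`), so they lie in the `ρ₂`-window of one of `≤ 16` caustic translates, each of measure `≤ 3·6√(δ/c)`
(`window_volume_le_frame`).  With `c ≍ w·u_min²` (`transCurve_second_deriv_ge_on_window`) this is the `ε₂^{1/2}` term of DECOMP Lemma E.3 for the frame band,
uniformly in the degree of the frame `K`.
Everything is PROVED; no definitions, no named facts; nothing asserts any stub or superconductivity.
References: DECOMP App. E Lemma E.3; FST II App. B [cite: FeldmanSalmhoferTrubowitz1998]; BGM 2006 §2.7 [cite: BenfattoGiulianiMastropietro2006].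
-/

noncomputable section

namespace Summit.HubbardSuperconductivity.HubbardSuperconductivity.Theorems.PerturbedFermiCurve

set_option linter.dupNamespace false -- summit = problem name (single-conjunct summit), D-0017

open Real Set MeasureTheory
open scoped ENNReal
open Literature.MathematicalPhysics.QuantumLattice Literature.MathematicalPhysics.QuantumLattice.BandSectorCounting
open Literature.MathematicalPhysics.QuantumLattice.FermiRG
open Summit.HubbardSuperconductivity.HubbardSuperconductivity.Theorems.DispersionFlow
open Summit.HubbardSuperconductivity.HubbardSuperconductivity.Theorems.KLRegimeSplit

section Frame

variable {a b : ℝ} (B : BandBounds a b) {K : TrigPolyC4v} {κ₀ κ₁ : ℝ}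
  (hδ : ∀ k : Fin 2 → ℝ, (∀ i, |k i| ≤ π) → |(fun k : Fin 2 → ℝ => -K.eval k) k| ≤ κ₀)
  (hκ : ∀ k : Fin 2 → ℝ, (∀ i, |k i| ≤ π) → ‖fderiv ℝ (fun k : Fin 2 → ℝ => -K.eval k) k‖ ≤ κ₁) (hκ₁ : κ₁ < B.Dtmin)
  {μ Kc r₀ g₀ w : ℝ} (hG : GeomConstants (frameLevel μ K) Kc r₀ g₀ w) {ν : ℝ} (hν : |ν - μ| < r₀)
include B hδ hκ hκ₁ hG hν

/-- **Angular bound, caustic regime, on the frame's Fermi curve** (frame twin of `klsh_volume_sublevel_le_caustic`; see the module docstring — all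
hypotheses are explicit inequalities between `(η, λ, δ, ℓ, η₁, ρ₂, c, R₀)` and the constants of `BandBounds`/`GeomConstants`). [cite: FeldmanSalmhoferTrubowitz1998, App. B] -/
theorem volume_sublevel_le_caustic_of_geomConstants {v : Fin 2 → ℝ} {η lam δ ℓ η₁ ρ₂ c R₀ : ℝ} (θ₀ : ℝ)
    (hlo : a ≤ ν - κ₀ - η) (hhi : ν + κ₀ + η ≤ b) (hδη : δ ≤ η) (hδ0 : 0 < δ) (hlam : 0 < lam)
    (hδl : δ / (2 * lam) ≤ 2 * π)
    (hfar : ∀ m : Fin 2 → ℤ, ∃ i, R₀ < |v i + m i * (2 * π)|)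
    (hR1 : (η + B.smax * B.Dtmin *
        ((π / 2 * (2 * lam) / ((B.Dtmin - κ₁) * B.umin) + π * Kc * η / (B.Dtmin - κ₁) ^ 2) * (4 + κ₁) / (B.umin * w))) / (B.Dtmin - κ₁) ≤ R₀)
    (hρ₂a : (η + B.smax * B.Dtmin *
        ((π / 2 * (2 * lam) / ((B.Dtmin - κ₁) * B.umin) + π * Kc * η / (B.Dtmin - κ₁) ^ 2) * (4 + κ₁) / (B.umin * w))) / (B.Dtmin - κ₁) +
        2 * (B.smax + κ₁ * (π * Real.sqrt 2 + 2 * B.smax) / (B.Dtmin - κ₁)) * (δ / (2 * lam)) ≤ ρ₂)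
    (hlo₁ : a ≤ ν - κ₀ - η₁) (hhi₁ : ν + κ₀ + η₁ ≤ b) (hℓ : 0 < ℓ)
    (hηℓ : Kc * (Real.sqrt 2 * (B.smax + κ₁ * (π * Real.sqrt 2 + 2 * B.smax) / (B.Dtmin - κ₁))) * ℓ ≤ η₁)
    (hR0 : (η₁ + B.smax * B.Dtmin * ((π * Kc * η₁ / (B.Dtmin - κ₁) ^ 2) * (4 + κ₁) / (B.umin * w))) / (B.Dtmin - κ₁) ≤ R₀)
    (hρ₂c : (η₁ + B.smax * B.Dtmin * ((π * Kc * η₁ / (B.Dtmin - κ₁) ^ 2) * (4 + κ₁) / (B.umin * w))) / (B.Dtmin - κ₁) +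
        2 * (B.smax + κ₁ * (π * Real.sqrt 2 + 2 * B.smax) / (B.Dtmin - κ₁)) * ℓ ≤ ρ₂)
    (hρ₂π : ρ₂ < 2 * π) (hσ : ρ₂ / (Real.sqrt 2 * B.umin) < 2) (hc : 0 < c)
    (hcwin : ∀ (m : Fin 2 → ℤ) (θ : ℝ), (∀ i, |2 * (perturbedFermiRadius (fun k : Fin 2 → ℝ => -K.eval k) ν θ • dir θ) i - v i - m i * (2 * π)| ≤
        ρ₂ + 2 * (B.smax + κ₁ * (π * Real.sqrt 2 + 2 * B.smax) / (B.Dtmin - κ₁)) * (π * (ρ₂ / (Real.sqrt 2 * B.umin)))) →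
      c ≤ fderiv ℝ (fderiv ℝ (frameLevel μ K)) (WithLp.toLp 2 (perturbedFermiRadius (fun k : Fin 2 → ℝ => -K.eval k) ν θ • dir θ - v))
            (WithLp.toLp 2 ![VXE (perturbedFermiRadius (fun k : Fin 2 → ℝ => -K.eval k) ν) θ, VYE (perturbedFermiRadius (fun k : Fin 2 → ℝ => -K.eval k) ν) θ])
            (WithLp.toLp 2 ![VXE (perturbedFermiRadius (fun k : Fin 2 → ℝ => -K.eval k) ν) θ, VYE (perturbedFermiRadius (fun k : Fin 2 → ℝ => -K.eval k) ν) θ]) +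
        fderiv ℝ (frameLevel μ K) (WithLp.toLp 2 (perturbedFermiRadius (fun k : Fin 2 → ℝ => -K.eval k) ν θ • dir θ - v))
          (WithLp.toLp 2 ![deriv (deriv (perturbedFermiRadius (fun k : Fin 2 → ℝ => -K.eval k) ν)) θ * Real.cos θ -
                2 * deriv (perturbedFermiRadius (fun k : Fin 2 → ℝ => -K.eval k) ν) θ * Real.sin θ -
                perturbedFermiRadius (fun k : Fin 2 → ℝ => -K.eval k) ν θ * Real.cos θ,
              deriv (deriv (perturbedFermiRadius (fun k : Fin 2 → ℝ => -K.eval k) ν)) θ * Real.sin θ +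
                2 * deriv (perturbedFermiRadius (fun k : Fin 2 → ℝ => -K.eval k) ν) θ * Real.cos θ -
                perturbedFermiRadius (fun k : Fin 2 → ℝ => -K.eval k) ν θ * Real.sin θ])) :
    volume {θ ∈ Icc θ₀ (θ₀ + 2 * π) |
        |sqDispersion (perturbedFermiRadius (fun k : Fin 2 → ℝ => -K.eval k) ν θ • dir θ - v) +
            -K.eval (perturbedFermiRadius (fun k : Fin 2 → ℝ => -K.eval k) ν θ • dir θ - v) - ν| ≤ δ} ≤
      ENNReal.ofReal (3 * (2 * π / ℓ + 97)) * ENNReal.ofReal (δ / lam) + 48 * ENNReal.ofReal (6 * Real.sqrt (δ / c)) := by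
  classical
  set δK : (Fin 2 → ℝ) → ℝ := fun k : Fin 2 → ℝ => -K.eval k with hδK
  set u := perturbedFermiRadius δK ν with hudef
  set SE := B.smax + κ₁ * (π * Real.sqrt 2 + 2 * B.smax) / (B.Dtmin - κ₁) with hSE
  set f := frameLevel μ K with hf
  have hπ := Real.pi_pos
  have hη : 0 ≤ η := hδ0.le.trans hδη
  have hκ₀ : 0 ≤ κ₀ := by
    have h := hδ (fun _ => 0) (fun i => by simp [Real.pi_pos.le])
    exact (abs_nonneg _).trans h
  have hlo' : a ≤ ν - κ₀ := by linarith
  have hhi' : ν + κ₀ ≤ b := by linarith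
  have hδc : Continuous δK := (contDiff_frameShift_toLp K (m := 0)).continuous
  have hδs : ContDiff ℝ 2 δK := contDiff_frameShift_toLp K
  have hu : ∀ θ, IsBandFermiRadius (ν - δK (u θ • dir θ)) θ (u θ) := isBandFermiRadius_perturbedFermiRadius B hδc hδ hlo' hhi'
  have hper : Function.Periodic u (2 * π) := fun θ => perturbedFermiRadius_add_two_pi δK ν θ
  have h2ne : (2 : WithTop ℕ∞) ≠ 0 := by norm_num
  have hu2 : ContDiff ℝ 2 u := contDiff_of_isRoot B hδs h2ne hδ hlo' hhi' hκ hκ₁ hu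
  have hud : ∀ z, DifferentiableAt ℝ u z := fun z => (hu2.differentiable h2ne) z
  -- the level function and its derivative
  set G : ℝ → ℝ := fun z => sqDispersion (u z • dir z - v) + -K.eval (u z • dir z - v) - ν with hGdef
  set G' : ℝ → ℝ := fun z => fderiv ℝ f (WithLp.toLp 2 (u z • dir z - v)) (WithLp.toLp 2 ![VXE u z, VYE u z]) with hG'
  have hGfun : G = fun z => f (WithLp.toLp 2 (u z • dir z - v)) + (μ - ν) := by
    funext z
    simp only [hGdef, hf, frameLevel_toLp, frameShift_toLp]
    ring
  have hGd : ∀ t, HasDerivAt G (G' t) t := fun t => by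
    rw [hGfun]
    exact (hasDerivAt_frameLevel_transCurve μ K (hud t) v).add_const (μ - ν)
  set Λ := 2 * lam with hΛ
  have hΛ0 : 0 < Λ := by positivity
  have hδΛ : δ / Λ = δ / (2 * lam) := rfl
  set P := Icc θ₀ (θ₀ + 2 * π) with hP
  set T := {θ ∈ P | |G θ| ≤ δ} with hT
  have hSE0 : 0 ≤ SE := by
    have h0 := abs_curve_sub_le_frame B hδ hlo' hhi' hκ hκ₁ hu (θ₀ + 1) θ₀ 0
    rw [show θ₀ + 1 - θ₀ = (1 : ℝ) by ring, abs_one, mul_one] at h0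
    exact (abs_nonneg _).trans h0
  -- zeros of three periods
  have hcount : ∀ θ₁ : ℝ, ∃ Z : Finset ℝ, (Z.card : ℝ) ≤ 2 * π / ℓ + 97 ∧
      ∀ z ∈ Icc θ₁ (θ₁ + 2 * π), sqDispersion (u z • dir z - v) + -K.eval (u z • dir z - v) = ν → z ∈ Z :=
    fun θ₁ => zeros_card_le_awayFromCooper_frame B hδ hκ hκ₁ hG hν θ₁ hlo₁ hhi₁ hℓ hηℓ hfar hR0 hρ₂c hρ₂π hσ hc hcwin
  choose Zp hZp_card hZp_mem using hcount
  set Z₃ : Finset ℝ := Zp (θ₀ - 2 * π) ∪ Zp θ₀ ∪ Zp (θ₀ + 2 * π) with hZ₃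
  have hZ₃card : (Z₃.card : ℝ) ≤ 3 * (2 * π / ℓ + 97) := by
    have hc1 := Finset.card_union_le (Zp (θ₀ - 2 * π) ∪ Zp θ₀) (Zp (θ₀ + 2 * π))
    have hc2 := Finset.card_union_le (Zp (θ₀ - 2 * π)) (Zp θ₀)
    have e1 : ((Zp (θ₀ - 2 * π) ∪ Zp θ₀ ∪ Zp (θ₀ + 2 * π)).card : ℝ) ≤
        ((Zp (θ₀ - 2 * π) ∪ Zp θ₀).card : ℝ) + (Zp (θ₀ + 2 * π)).card := by exact_mod_cast hc1
    have e2 : ((Zp (θ₀ - 2 * π) ∪ Zp θ₀).card : ℝ) ≤ (Zp (θ₀ - 2 * π)).card + (Zp θ₀).card := by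
      exact_mod_cast hc2
    linarith [hZp_card (θ₀ - 2 * π), hZp_card θ₀, hZp_card (θ₀ + 2 * π)]
  have hZ₃mem : ∀ c' ∈ Icc (θ₀ - 2 * π) (θ₀ + 4 * π), G c' = 0 → c' ∈ Z₃ := by
    intro c' hc' hGc
    have hGc' : sqDispersion (u c' • dir c' - v) + -K.eval (u c' • dir c' - v) = ν := by
      have : sqDispersion (u c' • dir c' - v) + -K.eval (u c' • dir c' - v) - ν = 0 := hGc
      linarith
    rw [hZ₃]
    rcases le_or_gt c' θ₀ with hc0 | hc0
    · exact Finset.mem_union_left _ (Finset.mem_union_left _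
        (hZp_mem _ c' ⟨hc'.1, by linarith⟩ hGc'))
    · rcases le_or_gt c' (θ₀ + 2 * π) with hc1 | hc1
      · exact Finset.mem_union_left _ (Finset.mem_union_right _ (hZp_mem _ c' ⟨hc0.le, hc1⟩ hGc'))
      · exact Finset.mem_union_right _ (hZp_mem _ c' ⟨hc1.le, by linarith [hc'.2]⟩ hGc')
  -- good and bad points
  set Tgood := {θ ∈ P | |G θ| ≤ δ ∧ ∀ t, |t - θ| ≤ δ / Λ → |G t| ≤ δ → Λ ≤ |G' t|} with hTgood
  set Tbad := {θ ∈ P | |G θ| ≤ δ ∧ ∃ t, |t - θ| ≤ δ / Λ ∧ |G t| ≤ δ ∧ |G' t| < Λ} with hTbad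
  have hsplit : T ⊆ Tgood ∪ Tbad := by
    intro θ hθ
    by_cases hgood : ∀ t, |t - θ| ≤ δ / Λ → |G t| ≤ δ → Λ ≤ |G' t|
    · exact Or.inl ⟨hθ.1, hθ.2, hgood⟩
    · push Not at hgood
      obtain ⟨t, ht1, ht2, ht3⟩ := hgood
      exact Or.inr ⟨hθ.1, hθ.2, t, ht1, ht2, ht3⟩
  -- the good part: balls around the zeros of three periods
  have hgood_cover : Tgood ⊆ ⋃ c' ∈ Z₃, Icc (c' - δ / Λ) (c' + δ / Λ) := by
    intro θ hθ
    obtain ⟨hθP, hGθ, hsl⟩ := hθ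
    obtain ⟨c', hθc, hGc⟩ := klsg_exists_zero_near hGd hΛ0 hGθ hsl
    have hcI : c' ∈ Icc (θ₀ - 2 * π) (θ₀ + 4 * π) := by
      rw [abs_le] at hθc; rw [hδΛ] at hθc; constructor <;> linarith [hθP.1, hθP.2, hθc.1, hθc.2]
    have hcZ := hZ₃mem c' hcI hGc
    simp only [mem_iUnion, mem_Icc, exists_prop]
    refine ⟨c', hcZ, ?_, ?_⟩
    · have := (abs_le.1 hθc).1; linarith
    · have := (abs_le.1 hθc).2; linarith
  have hgood_vol : volume Tgood ≤ ENNReal.ofReal (3 * (2 * π / ℓ + 97)) * ENNReal.ofReal (δ / lam) := by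
    refine (measure_mono hgood_cover).trans ((measure_biUnion_finset_le _ _).trans ?_)
    have hvol : ∀ c' : ℝ, volume (Icc (c' - δ / Λ) (c' + δ / Λ)) = ENNReal.ofReal (δ / lam) := by
      intro c'; rw [Real.volume_Icc]; congr 1; rw [hδΛ]; field_simp; ring
    simp only [hvol, Finset.sum_const, nsmul_eq_mul]
    gcongr
    calc (Z₃.card : ℝ≥0∞) = ENNReal.ofReal (Z₃.card : ℝ) := by simp
      _ ≤ ENNReal.ofReal (3 * (2 * π / ℓ + 97)) := ENNReal.ofReal_le_ofReal hZ₃card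
  -- the bad part: caustic windows of the sixteen translates in reach
  set n0 : ℤ := ⌊-v 0 / (2 * π)⌋ with hn0
  set n1 : ℤ := ⌊-v 1 / (2 * π)⌋ with hn1
  set S0 : Finset ℤ := {n0 - 1, n0, n0 + 1, n0 + 2} with hS0
  set S1 : Finset ℤ := {n1 - 1, n1, n1 + 1, n1 + 2} with hS1
  set Mfin : Finset (Fin 2 → ℤ) := (S0 ×ˢ S1).image (fun mm : ℤ × ℤ => (![mm.1, mm.2] : Fin 2 → ℤ)) with hMfin
  have hS0card : S0.card ≤ 4 := by
    rw [hS0]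
    refine (Finset.card_insert_le _ _).trans ?_
    refine Nat.succ_le_succ ((Finset.card_insert_le _ _).trans ?_)
    exact Nat.succ_le_succ ((Finset.card_insert_le _ _).trans (by simp))
  have hS1card : S1.card ≤ 4 := by
    rw [hS1]
    refine (Finset.card_insert_le _ _).trans ?_
    refine Nat.succ_le_succ ((Finset.card_insert_le _ _).trans ?_)
    exact Nat.succ_le_succ ((Finset.card_insert_le _ _).trans (by simp))
  have hMcard : Mfin.card ≤ 16 := by
    rw [hMfin]
    refine Finset.card_image_le.trans ?_
    rw [Finset.card_product]
    calc S0.card * S1.card ≤ 4 * 4 := Nat.mul_le_mul hS0card hS1card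
      _ = 16 := by norm_num
  set V : (Fin 2 → ℤ) → Set ℝ := fun m => {z ∈ Icc θ₀ (θ₀ + 2 * π) |
      |sqDispersion (u z • dir z - v) + -K.eval (u z • dir z - v) - ν| ≤ δ ∧
        ∀ i, |2 * (u z • dir z) i - v i - m i * (2 * π)| ≤ ρ₂} with hV
  have hVvol : ∀ m : Fin 2 → ℤ, volume (V m) ≤ 3 * ENNReal.ofReal (6 * Real.sqrt (δ / c)) :=
    fun m => window_volume_le_frame B hδ hlo' hhi' hκ hκ₁ hu hper v m θ₀ hδ0 hc hσ (hcwin m)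
  have hbad_cover : Tbad ⊆ ⋃ m ∈ Mfin, V m := by
    intro θ hθ
    obtain ⟨hθP, hGθ, t, htθ, hGt, hG't⟩ := hθ
    -- the near-tangent point `t` is odd-aligned
    have hlev : |sqDispersion (u t • dir t - v) + -K.eval (u t • dir t - v) - ν| ≤ η := hGt.trans hδη
    have hslope : |fderiv ℝ f (WithLp.toLp 2 (u t • dir t - v)) (WithLp.toLp 2 ![VXE u t, VYE u t])| ≤ 2 * lam := hG't.le
    obtain ⟨m, hm⟩ := nearTangent_near_caustic_momentum B hδ hκ hκ₁ hG hν t hlev hslope hlo hhi hfar hR1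
    -- `2p(θ)` is within `ρ₂` of the same translate
    have hθt : |θ - t| ≤ δ / (2 * lam) := by rw [abs_sub_comm]; exact htθ
    have hθw : ∀ i, |2 * (u θ • dir θ) i - v i - m i * (2 * π)| ≤ ρ₂ := by
      intro i
      have hL := abs_curve_sub_le_frame B hδ hlo' hhi' hκ hκ₁ hu θ t i
      have hL' : |(u θ • dir θ) i - (u t • dir t) i| ≤ SE * (δ / (2 * lam)) := hL.trans (mul_le_mul_of_nonneg_left hθt hSE0)
      obtain ⟨a1, a2⟩ := abs_le.1 hL'
      obtain ⟨b1, b2⟩ := abs_le.1 (hm i)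
      rw [abs_le]; constructor <;> linarith [hρ₂a]
    -- the translate is one of the sixteen in reach
    have h2π : (0 : ℝ) < 2 * π := by positivity
    have hnear : ∀ i, |-v i / (2 * π) - m i| < 2 := by
      intro i
      have hX : |(u θ • dir θ) i| < π := abs_apply_lt_pi_of_shifted B hδ hlo' hhi' (hu θ) i
      obtain ⟨hX1, hX2⟩ := abs_lt.1 hX
      obtain ⟨hw1, hw2⟩ := abs_le.1 (hθw i)
      have hlt : |-v i - m i * (2 * π)| < 2 * (2 * π) := by
        rw [abs_lt]; constructor <;> linarith
      have e : -v i / (2 * π) - m i = (-v i - m i * (2 * π)) / (2 * π) := by field_simp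
      rw [e, abs_div, abs_of_pos h2π, div_lt_iff₀ h2π]
      exact hlt
    have hm0 : m 0 ∈ S0 := int_mem_quad_of_abs_sub_lt_two (hnear 0)
    have hm1 : m 1 ∈ S1 := int_mem_quad_of_abs_sub_lt_two (hnear 1)
    have hmM : m ∈ Mfin := by
      rw [hMfin, Finset.mem_image]
      refine ⟨(m 0, m 1), Finset.mem_product.2 ⟨hm0, hm1⟩, ?_⟩
      funext i; fin_cases i <;> rfl
    simp only [mem_iUnion, exists_prop]
    exact ⟨m, hmM, hθP, hGθ, hθw⟩
  have hbad_vol : volume Tbad ≤ 48 * ENNReal.ofReal (6 * Real.sqrt (δ / c)) := by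
    refine (measure_mono hbad_cover).trans ((measure_biUnion_finset_le _ _).trans ?_)
    calc ∑ m ∈ Mfin, volume (V m) ≤ ∑ _m ∈ Mfin, 3 * ENNReal.ofReal (6 * Real.sqrt (δ / c)) :=
          Finset.sum_le_sum (fun m _ => hVvol m)
      _ = Mfin.card * (3 * ENNReal.ofReal (6 * Real.sqrt (δ / c))) := by
          rw [Finset.sum_const, nsmul_eq_mul]
      _ ≤ 16 * (3 * ENNReal.ofReal (6 * Real.sqrt (δ / c))) := by
          gcongr; exact_mod_cast hMcard
      _ = 48 * ENNReal.ofReal (6 * Real.sqrt (δ / c)) := by ring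
  calc volume T ≤ volume (Tgood ∪ Tbad) := measure_mono hsplit
    _ ≤ volume Tgood + volume Tbad := measure_union_le _ _
    _ ≤ _ := add_le_add hgood_vol hbad_vol

end Frame

end Summit.HubbardSuperconductivity.HubbardSuperconductivity.Theorems.PerturbedFermiCurve

end
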